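import Literature.AlgebraicGeometry.Limits.LocalizationOpenDescent
import HarnessLib

/-!
# Limits of schemes: isomorphic over `Spec A_S` ⇒ *compatibly* isomorphic over some `D(s)`

Topic: `Literature/AlgebraicGeometry/Limits`; complement to `Limits/LocalizationIsoSpread`
(`LocApprox.exists_iso_of_iso_tensor_specOver`: for `A`-schemes `P₁, P₂` quasi-compact,
quasi-separated and locally of finite presentation, an isomorphism
`θ : P₁ ⊗ Spec B ≅ P₂ ⊗ Spec B` over `Spec B = Spec A_S` spreads out to an isomorphism
`e : P₁ ⊗ Spec A[1/t] ≅ P₂ ⊗ Spec A[1/t]` over `Spec A[1/t]` for some `t ∈ S`). The proof there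
constructs `e` as a spreading-out of `θ`, but the statement forgets it; here we record the
**compatibility `(P₁ ◁ π_t) ≫ e.hom = θ.hom ≫ (P₂ ◁ π_t)`** — `e` restricts to `θ` on
`P₁ ⊗ Spec B → P₂ ⊗ Spec A[1/t]` (`exists_iso_whiskerLeft_leg_comp_eq`; Görtz–Wedhorn I,
Thm. 10.63 / Cor. 10.64: the functor `X_λ ↦ X_λ ×_{S_λ} S` on the colimit of the categories of
schemes of finite presentation over the `S_λ` is fully faithful, so the isomorphism at a finite
stage may be chosen to induce the given one). This is what gluing two descended charts along a
*prescribed* identification of their overlap needs (`Limits/LocalizationTwoOpensDescent`). The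
proof repeats that of `exists_iso_of_iso_tensor_specOver` and reads the compatibility off the
construction (post-composing with the monomorphism `P₂ ◁ (Spec A[1/t] → Spec A[1/s])`).

## References

* U. Görtz, T. Wedhorn, *Algebraic Geometry I: Schemes*, 2nd ed. (2020), Thm. 10.63 and
  Cor. 10.64, pp. 328–329. [GortzWedhorn2020]
* A. Grothendieck, EGA IV₃, Thm. 8.8.2 (i) and 8.8.2.5 (Publ. Math. IHÉS 28, 1966). [EGAIV3]
* The Stacks project, Tag 01ZC. [StacksProject]
-/

noncomputable section

universe u

open CategoryTheory CategoryTheory.Limits AlgebraicGeometry TopologicalSpace MonoidalCategory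
  CartesianMonoidalCategory
open Opposite

namespace Literature.AlgebraicGeometry.Limits

namespace LocApprox

open Literature.AlgebraicGeometry.Motives (SchemeOver specOver)

set_option backward.isDefEq.respectTransparency false

variable {A : Type u} [CommRing A] (S : Submonoid A) (B : Type u) [CommRing B] [Algebra A B]
  [IsLocalization S B]
variable {P₁ P₂ : SchemeOver A} [QuasiCompact P₁.hom] [QuasiSeparated P₁.hom]
  [LocallyOfFinitePresentation P₁.hom] [QuasiCompact P₂.hom] [QuasiSeparated P₂.hom]
  [LocallyOfFinitePresentation P₂.hom]

/-- **Isomorphic over `Spec A_S` implies compatibly isomorphic over some `D(t)`, `t ∈ S`.** Let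
`P₁, P₂ → Spec A` be quasi-compact, quasi-separated and locally of finite presentation and
`θ : P₁ ⊗ Spec B ≅ P₂ ⊗ Spec B` an isomorphism over `Spec B` (`B = A_S`). Then for some `t ∈ S`
there is an isomorphism `e : P₁ ⊗ Spec A[1/t] ≅ P₂ ⊗ Spec A[1/t]` over `Spec A[1/t]` which
restricts to `θ`: `(P₁ ◁ π_t) ≫ e.hom = θ.hom ≫ (P₂ ◁ π_t)`. Proof as for
`exists_iso_of_iso_tensor_specOver` (spread out `θ.hom ≫ fst`, `θ.inv ≫ fst` to a stage, pass to
a finer stage where the two composites are identities); the compatibility holds after composing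
with the monomorphism `P₂ ◁ (Spec A[1/t] → Spec A[1/s])`, where it is the defining property of
the spread-out morphism. [cite: GortzWedhorn2020, Thm. 10.63 and Cor. 10.64 (2), pp. 328–329] -/
theorem exists_iso_whiskerLeft_leg_comp_eq (θ : P₁ ⊗ specOver A B ≅ P₂ ⊗ specOver A B)
    (hθ : θ.hom ≫ snd _ _ = snd _ _) :
    ∃ (t : Idx S) (e : P₁ ⊗ (baseDiagram S).obj t ≅ P₂ ⊗ (baseDiagram S).obj t),
      e.hom ≫ snd _ _ = snd _ _ ∧ (P₁ ◁ leg S B t) ≫ e.hom = θ.hom ≫ (P₂ ◁ leg S B t) := by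
  have hθ' : θ.inv ≫ snd _ _ = snd _ _ := by
    rw [Iso.inv_comp_eq, hθ]
  have hπ : ∀ {t s : Idx S} (h : t ⟶ s), leg S B t ≫ (baseDiagram S).map h = leg S B s :=
    fun h => leg_comp_map B h
  -- spread out `θ.hom ≫ fst` and `θ.inv ≫ fst`
  obtain ⟨s₁, α₁, hα₁⟩ :=
    exists_whiskerLeft_comp_eq (S := S) B (P := P₁) (X := P₂) (θ.hom ≫ fst _ _)
  obtain ⟨s₂, β₂, hβ₂⟩ :=
    exists_whiskerLeft_comp_eq (S := S) B (P := P₂) (X := P₁) (θ.inv ≫ fst _ _)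
  -- common refinement `s`
  obtain ⟨s, ⟨h₁⟩, ⟨h₂⟩⟩ := exists_hom₂ S s₁ s₂
  let α : P₁ ⊗ (baseDiagram S).obj s ⟶ P₂ := resStage h₁ α₁
  let β : P₂ ⊗ (baseDiagram S).obj s ⟶ P₁ := resStage h₂ β₂
  have hα : (P₁ ◁ leg S B s) ≫ α = θ.hom ≫ fst _ _ := by
    change (P₁ ◁ leg S B s) ≫ (P₁ ◁ (baseDiagram S).map h₁) ≫ α₁ = _
    rw [← MonoidalCategory.whiskerLeft_comp_assoc, hπ h₁]
    exact hα₁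
  have hβ : (P₂ ◁ leg S B s) ≫ β = θ.inv ≫ fst _ _ := by
    change (P₂ ◁ leg S B s) ≫ (P₂ ◁ (baseDiagram S).map h₂) ≫ β₂ = _
    rw [← MonoidalCategory.whiskerLeft_comp_assoc, hπ h₂]
    exact hβ₂
  have kα : (P₁ ◁ leg S B s) ≫ overStage α = θ.hom ≫ (P₂ ◁ leg S B s) :=
    whiskerLeft_π_overStage B α θ.hom hθ hα
  have kβ : (P₂ ◁ leg S B s) ≫ overStage β = θ.inv ≫ (P₁ ◁ leg S B s) :=
    whiskerLeft_π_overStage B β θ.inv hθ' hβ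
  -- the two composites are the identity at the limit, hence over finer stages `t₁`, `t₂`
  obtain ⟨t₁, k₁, e₁⟩ := exists_whiskerLeft_map_comp_eq (S := S) B (P := P₁)
    (X := P₁ ⊗ (baseDiagram S).obj s) (overStage α ≫ overStage β) (𝟙 _) (by
      rw [reassoc_of% kα, kβ, Iso.hom_inv_id_assoc, Category.comp_id])
  obtain ⟨t₂, k₂, e₂⟩ := exists_whiskerLeft_map_comp_eq (S := S) B (P := P₂)
    (X := P₂ ⊗ (baseDiagram S).obj s) (overStage β ≫ overStage α) (𝟙 _) (by
      rw [reassoc_of% kβ, kα, Iso.inv_hom_id_assoc, Category.comp_id])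
  -- common refinement `t`
  obtain ⟨t, ⟨l₁⟩, ⟨l₂⟩⟩ := exists_hom₂ S t₁ t₂
  have hk : l₁ ≫ k₁ = l₂ ≫ k₂ := Subsingleton.elim _ _
  let αt := overStage (resStage (l₁ ≫ k₁) α)
  let βt := overStage (resStage (l₁ ≫ k₁) β)
  have hαt : αt ≫ (P₂ ◁ (baseDiagram S).map (l₁ ≫ k₁)) =
      (P₁ ◁ (baseDiagram S).map (l₁ ≫ k₁)) ≫ overStage α :=
    overStage_resStage_whiskerLeft _ _
  have hβt : βt ≫ (P₁ ◁ (baseDiagram S).map (l₁ ≫ k₁)) =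
      (P₂ ◁ (baseDiagram S).map (l₁ ≫ k₁)) ≫ overStage β :=
    overStage_resStage_whiskerLeft _ _
  have e₁' : (P₁ ◁ (baseDiagram S).map (l₁ ≫ k₁)) ≫ overStage α ≫ overStage β =
      P₁ ◁ (baseDiagram S).map (l₁ ≫ k₁) := by
    rw [Functor.map_comp, MonoidalCategory.whiskerLeft_comp, Category.assoc, e₁, Category.comp_id]
  have e₂' : (P₂ ◁ (baseDiagram S).map (l₁ ≫ k₁)) ≫ overStage β ≫ overStage α =
      P₂ ◁ (baseDiagram S).map (l₁ ≫ k₁) := by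
    rw [hk, Functor.map_comp, MonoidalCategory.whiskerLeft_comp, Category.assoc, e₂,
      Category.comp_id]
  refine ⟨t, ⟨αt, βt, ?_, ?_⟩, overStage_snd _, ?_⟩
  · rw [← cancel_mono (P₁ ◁ (baseDiagram S).map (l₁ ≫ k₁)), Category.assoc, hβt,
      reassoc_of% hαt, e₁', Category.id_comp]
  · rw [← cancel_mono (P₂ ◁ (baseDiagram S).map (l₁ ≫ k₁)), Category.assoc, hαt,
      reassoc_of% hβt, e₂', Category.id_comp]
  · -- compatibility with `θ`, checked after the monomorphism `P₂ ◁ (D(t) → D(s))`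
    change (P₁ ◁ leg S B t) ≫ αt = θ.hom ≫ (P₂ ◁ leg S B t)
    rw [← cancel_mono (P₂ ◁ (baseDiagram S).map (l₁ ≫ k₁)), Category.assoc, hαt,
      ← MonoidalCategory.whiskerLeft_comp_assoc, hπ, kα, Category.assoc,
      ← MonoidalCategory.whiskerLeft_comp, hπ]

/-- **Pullback-language version.** An isomorphism `k : P₁ ×_A Spec B ≅ P₂ ×_A Spec B` over
`Spec B` comes, for some `t ∈ S`, from an isomorphism `e : P₁ ⊗ Spec A[1/t] ≅ P₂ ⊗ Spec A[1/t]`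
over `Spec A[1/t]` whose restriction to `P₁ ⊗ Spec B` has total-space component `k.hom.left`
followed by `P₂ ⊗ Spec B → P₂ ⊗ Spec A[1/t]`. [cite: GortzWedhorn2020, Cor. 10.64 (2), p. 329] -/
theorem exists_iso_whiskerLeft_leg_comp_eq_of_pullback_iso
    (k : (Over.pullback (specOver A B).hom).obj P₁ ≅ (Over.pullback (specOver A B).hom).obj P₂) :
    ∃ (t : Idx S) (e : P₁ ⊗ (baseDiagram S).obj t ≅ P₂ ⊗ (baseDiagram S).obj t),
      e.hom ≫ snd _ _ = snd _ _ ∧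
        (P₁ ◁ leg S B t).left ≫ e.hom.left = k.hom.left ≫ (P₂ ◁ leg S B t).left := by
  obtain ⟨t, e, he, hcomp⟩ := exists_iso_whiskerLeft_leg_comp_eq S B
    (tensorIsoOfPullbackIso _ k) (tensorIsoOfPullbackIso_hom_snd _ k)
  refine ⟨t, e, he, ?_⟩
  have h := congrArg CommaMorphism.left hcomp
  simpa only [Over.comp_left, tensorIsoOfPullbackIso_hom_left] using h

end LocApprox

end Literature.AlgebraicGeometry.Limits

end
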